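import Literature.Combinatorics.SimpleGraph.MengerTheorem
import HarnessLib

/-!
# Menger's theorem, vertex form (two non-adjacent vertices)

Topic `Literature/Combinatorics/SimpleGraph`; corollary of the set form (`MengerTheorem.lean`).
**Theorem** (Menger's theorem, vertex form; Chartrand–Jordon–Vatter–Zhang Thm. 4.18, Diestel
Cor. 3.3.5 (i)): for distinct non-adjacent vertices `u`, `v` of a finite graph, if every `u`–`v`
separating set contained in `V ∖ {u, v}` has at least `k` vertices, then there are `k` pairwise
internally disjoint `u`–`v` paths (`exists_internallyDisjoint_paths_of_forall_separator`). Proof as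
in Chartrand et al.: apply the set form to `A = N(u)`, `B = N(v)` (an `N(u)`–`N(v)` separator
remains one after removing `u` and `v`, `IsVxSeparator.diff_singleton_left/right`, and then
separates `u` from `v`), and attach `u` and `v` to the `k` disjoint strict `N(u)`–`N(v)` paths.

## References

* R. Diestel, *Graph Theory*, 5th ed. (2017), Cor. 3.3.5 [Diestel2017].
* G. Chartrand, H. Jordon, V. Vatter, P. Zhang, *Graphs & Digraphs*, 7th ed. (2024), Thm. 4.18.
-/

namespace Literature.Combinatorics.SimpleGraph

open _root_.SimpleGraph

universe u

variable {V : Type u} [DecidableEq V] {G : _root_.SimpleGraph V}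

/-! ### The vertex form (two non-adjacent vertices) -/

/-- **Removing `u` from an `N(u)`–`B` separator keeps a separator**, provided `u ∉ B`: after its
last visit of `u`, an `N(u)`–`B` walk restarts from a neighbour of `u` and avoids `u`.
[cite: Diestel2017, §3.3 (A–B separator)] -/
theorem IsVxSeparator.diff_singleton_left {u : V} {B S : Set V} (huB : u ∉ B)
    (hS : IsVxSeparator G (G.neighborSet u) B S) :
    IsVxSeparator G (G.neighborSet u) B (S \ {u}) := by
  classical
  intro a b ha hb W
  by_cases huW : u ∈ W.support
  · have hub : u ≠ b := fun h => huB (h ▸ hb)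
    have huW' : u ∈ W.reverse.support := by rw [Walk.support_reverse]; exact List.mem_reverse.2 huW
    -- the suffix of `W` after the last visit of `u`
    set Q : G.Walk u b := (W.reverse.takeUntil u huW').reverse with hQ
    have hcount : Q.support.count u = 1 := by
      rw [hQ, Walk.support_reverse, List.count_reverse]
      exact W.reverse.count_support_takeUntil_eq_one huW'
    have hQW : ∀ w ∈ Q.support, w ∈ W.support := by
      intro w hw
      rw [hQ, Walk.support_reverse, List.mem_reverse] at hw
      have := W.reverse.support_takeUntil_subset_support huW' hw
      rwa [Walk.support_reverse, List.mem_reverse] at this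
    obtain ⟨a', hadj, R, hQR⟩ := Walk.exists_eq_cons_of_ne hub Q
    have huR : u ∉ R.support := by
      intro huR
      rw [hQR, Walk.support_cons, List.count_cons_self] at hcount
      have : R.support.count u = 0 := by omega
      exact (List.count_eq_zero.1 this) huR
    obtain ⟨w, hw, hwS⟩ := hS hadj hb R
    refine ⟨w, hQW w (by rw [hQR, Walk.support_cons]; exact List.mem_cons_of_mem _ hw), hwS, ?_⟩
    rw [Set.mem_singleton_iff]
    rintro rfl
    exact huR hw
  · obtain ⟨w, hw, hwS⟩ := hS ha hb W
    refine ⟨w, hw, hwS, ?_⟩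
    rw [Set.mem_singleton_iff]
    rintro rfl
    exact huW hw

/-- Symmetrically, removing `v` from an `A`–`N(v)` separator keeps a separator if `v ∉ A`.
[cite: Diestel2017, §3.3 (A–B separator)] -/
theorem IsVxSeparator.diff_singleton_right {v : V} {A S : Set V} (hvA : v ∉ A)
    (hS : IsVxSeparator G A (G.neighborSet v) S) :
    IsVxSeparator G A (G.neighborSet v) (S \ {v}) :=
  (hS.symm.diff_singleton_left hvA).symm

omit [DecidableEq V] in
/-- **Menger's theorem, vertex form** (Chartrand et al. Thm. 4.18; Diestel Cor. 3.3.5 (i)): let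
`u ≠ v` be non-adjacent vertices of a finite graph. If every `u`–`v` separating set avoiding `u`
and `v` has at least `k` vertices, then there are `k` pairwise internally disjoint `u`–`v` paths.
Proof from the set form with `A = N(u)`, `B = N(v)`: an `N(u)`–`N(v)` separator minus `{u, v}` is
still one (`diff_singleton_left/right`) and then separates `u` from `v`; the `k` disjoint strict
`N(u)`–`N(v)` paths avoid `u` and `v` (strictness) and extend by the edges at `u` and `v`.
[cite: Diestel2017, Cor. 3.3.5] -/
theorem exists_internallyDisjoint_paths_of_forall_separator [Fintype V] (G : _root_.SimpleGraph V)
    {u v : V} (huv : u ≠ v) (hnadj : ¬ G.Adj u v) (k : ℕ)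
    (hk : ∀ X : Finset V, u ∉ X → v ∉ X → (∀ p : G.Walk u v, ∃ z ∈ p.support, z ∈ X) → k ≤ X.card) :
    ∃ p : Fin k → G.Walk u v, (∀ i, (p i).IsPath) ∧
      ∀ i j, i ≠ j → ∀ z ∈ (p i).support, z ∈ (p j).support → z = u ∨ z = v := by
  classical
  have huB : u ∉ G.neighborSet v := fun h => hnadj (G.adj_symm h)
  have hvA : v ∉ G.neighborSet u := fun h => hnadj h
  -- every `N(u)`–`N(v)` separator has `≥ k` vertices
  have hk' : ∀ S : Finset V, IsVxSeparator G (G.neighborSet u) (G.neighborSet v) ↑S → k ≤ S.card := by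
    intro S hS
    have hT := (hS.diff_singleton_left huB).diff_singleton_right hvA
    rw [← Finset.coe_erase, ← Finset.coe_erase] at hT
    have h1 : k ≤ ((S.erase u).erase v).card := by
      refine hk _ (fun h => (Finset.notMem_erase u S) (Finset.mem_of_mem_erase h))
        (Finset.notMem_erase _ _) fun p => ?_
      -- a `u`–`v` walk contains an `N(u)`–`N(v)` walk
      obtain ⟨a, hua, p', rfl⟩ := Walk.exists_eq_cons_of_ne huv p
      have hav : v ≠ a := fun h => hnadj (h ▸ hua)
      obtain ⟨b, hvb, r, hr⟩ := Walk.exists_eq_cons_of_ne hav p'.reverse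
      obtain ⟨z, hz, hzT⟩ := hT hua hvb r.reverse
      refine ⟨z, ?_, hzT⟩
      rw [Walk.support_cons, List.mem_cons, ← List.mem_reverse, ← Walk.support_reverse, hr,
        Walk.support_cons, List.mem_cons, ← List.mem_reverse, ← Walk.support_reverse]
      exact Or.inr (Or.inr hz)
    exact h1.trans ((Finset.card_erase_le (s := S.erase u) (a := v)).trans
      (Finset.card_erase_le (s := S) (a := u)))
  obtain ⟨P⟩ := exists_abPathSystem_fin_of_forall_isVxSeparator G (G.neighborSet u)
    (G.neighborSet v) k hk'
  -- the strict `N(u)`–`N(v)` paths avoid `u` and `v`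
  have huP : ∀ i, u ∉ (P.walk i).support := by
    intro i hu
    have hub : u ≠ P.lst i := fun h => huB (h ▸ P.lst_mem i)
    obtain ⟨a', hadj, R, hR⟩ := Walk.exists_eq_cons_of_ne hub ((P.walk i).dropUntil u hu)
    have ha'R : a' ∈ ((P.walk i).dropUntil u hu).support := by
      rw [hR, Walk.support_cons]; exact List.mem_cons_of_mem _ R.start_mem_support
    have ha' : a' = P.fst i :=
      P.eq_fst_of_mem i a' ((P.walk i).support_dropUntil_subset_support hu ha'R) hadj
    have hua : u = P.fst i :=
      IsPath.eq_of_mem_support_dropUntil_of_eq_start (P.isPath i) hu ha'R ha'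
    exact (P.fst_mem i).ne hua
  have hvP : ∀ i, v ∉ (P.walk i).support := by
    intro i hv
    have hv' : v ∈ (P.walk i).reverse.support := by
      rw [Walk.support_reverse]; exact List.mem_reverse.2 hv
    have hva : v ≠ P.fst i := fun h => hvA (h ▸ P.fst_mem i)
    obtain ⟨b', hadj, R, hR⟩ := Walk.exists_eq_cons_of_ne hva ((P.walk i).reverse.dropUntil v hv')
    have hb'R : b' ∈ ((P.walk i).reverse.dropUntil v hv').support := by
      rw [hR, Walk.support_cons]; exact List.mem_cons_of_mem _ R.start_mem_support
    have hb'P : b' ∈ (P.walk i).support := by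
      have := (P.walk i).reverse.support_dropUntil_subset_support hv' hb'R
      rwa [Walk.support_reverse, List.mem_reverse] at this
    have hb' : b' = P.lst i := P.eq_lst_of_mem i b' hb'P hadj
    have hvb : v = P.lst i :=
      IsPath.eq_of_mem_support_dropUntil_of_eq_start ((Walk.isPath_reverse_iff _).2 (P.isPath i))
        hv' hb'R hb'
    exact (G.adj_symm (P.lst_mem i)).ne hvb.symm
  -- extend by the edges at `u` and `v`
  have hua : ∀ i, G.Adj u (P.fst i) := fun i => P.fst_mem i
  have hbv : ∀ i, G.Adj (P.lst i) v := fun i => G.adj_symm (P.lst_mem i)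
  let full : ∀ i, G.Walk u v := fun i =>
    Walk.cons (hua i) ((P.walk i).append (Walk.cons (hbv i) Walk.nil))
  have hsupp : ∀ i, ∀ z ∈ (full i).support, z = u ∨ z = v ∨ z ∈ (P.walk i).support := by
    intro i z hz
    rw [Walk.support_cons, List.mem_cons, Walk.mem_support_append_iff, Walk.support_cons,
      Walk.support_nil, List.mem_cons, List.mem_singleton] at hz
    rcases hz with h | h | h | h
    · exact Or.inl h
    · exact Or.inr (Or.inr h)
    · exact Or.inr (Or.inr (h ▸ (P.walk i).end_mem_support))
    · exact Or.inr (Or.inl h)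
  refine ⟨fun i => full ⟨i⟩, fun i => ?_, fun i j hij z hzi hzj => ?_⟩
  · refine Walk.IsPath.cons ?_ ?_
    · rw [isPath_append_iff']
      refine ⟨P.isPath _, (Walk.IsPath.nil).cons (by simpa using (hbv ⟨i⟩).ne), fun y hy hy' => ?_⟩
      rw [Walk.support_cons, Walk.support_nil, List.mem_cons, List.mem_singleton] at hy'
      rcases hy' with h | rfl
      · exact h
      · exact absurd hy (hvP _)
    · rw [Walk.mem_support_append_iff, Walk.support_cons, Walk.support_nil, List.mem_cons,
        List.mem_singleton, not_or, not_or]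
      exact ⟨huP _, fun h => hnadj (h ▸ hbv ⟨i⟩), huv⟩
  · rcases hsupp ⟨i⟩ z hzi with h | h | hzi'
    · exact Or.inl h
    · exact Or.inr h
    · rcases hsupp ⟨j⟩ z hzj with h | h | hzj'
      · exact Or.inl h
      · exact Or.inr h
      · exact absurd hzj' (P.disjoint ⟨i⟩ ⟨j⟩ (fun h => hij (congrArg ULift.down h)) hzi')

end Literature.Combinatorics.SimpleGraph
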